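import Summits.QuantumFields.YangMills.Theorems.SwapVirialDeficitZeroModeGroupFourSmallBallTwoScaleLimit
import HarnessLib

/-!
# Exact zero-mode rung, FOUR pairwise nearly commuting letters — VI: the limit profile `h(κ) = vol³(T(0,0,κ))` — positive, continuous at `0⁺`,
# vanishing at `∞`
# (zero-mode block of crux ⟨stmt-QuantumFields-24497⟩ `ToronTubeVolumeLaw`; free-hands support of ⟨stmt-QuantumFields-24197⟩ / ⟨24497⟩)

The profile `h(κ) = vol³(twoScaleSet4 0 0 κ)` of part V (the `η → 0⁺` limit of the two-scale family at fixed `κ = t²‖a‖⁴/(4‖Im a‖⁴)`) governs the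
hub integral of part III: `h(κ) ≈ h(0)` on `‖Im a‖ ≫ √t` produces `h(0)·∫d‖Im a‖/‖Im a‖ = h(0)·½log(1/t)`, and `h(κ) → 0` for `‖Im a‖ ≪ √t` cuts the
logarithm off.  This file proves the three qualitative facts:
* §21 ★★ `tendsto_volume_twoScale_limit_zero` — `h(κ) → h(0)` as `κ → 0⁺` (dominated convergence; the obstruction is the pair boundary, null by part V);
* §22 ★★ `tendsto_volume_twoScale_limit_atTop` — `h(κ) → 0` as `κ → ∞` (a.e. the transverse parts of two letters are not parallel, and then the
  `κ`-term expels the point);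
* §23 ★★ `volume_twoScale_limit_pos` — `h(κ) > 0` for every `κ ≥ 0` (an explicit box), so the candidate log coefficient `∝ h(0)` is POSITIVE and FINITE.
Rates (`h(0) − h(κ) = O(κ^γ)`, `h(κ) = O(κ^{−γ'})`) — needed for the `O(t⁶)` remainder — are NOT proved here.
HONEST LABEL: finite-dimensional measure theory on `SU(2)⁴` (plan-level zero-mode rung of DRAFT lines); NOT ⟨24497⟩, NOT ⟨24197⟩; the Yang–Mills mass gap
is NOT proved; no summit is proved by a line.  Seat ym-line-fcl-p3 g44 (cell ym-idea-1, free hands), `--supports stmt-QuantumFields-24197`.  THEOREMS ONLY,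
standard axioms.  References: [cite: GonzalezarroyoAltes1988]; [cite: Vanbaal2001]; [cite: Luscher1983, §2]; [folklore].
-/

set_option autoImplicit false

noncomputable section

open MeasureTheory Quaternion Set Filter Topology
open scoped Quaternion ENNReal BigOperators
open Literature.MathematicalPhysics.QuantumLattice
open Summit.QuantumFields.YangMills.Theorems.SwapTwistDeficit.ToronLog

attribute [local instance] Literature.Analysis.FluidPDE.Tao2016.quatMeasurableSpace
  Literature.Analysis.FluidPDE.Tao2016.quatBorelSpace
  Literature.MathematicalPhysics.QuantumLattice.secondCountableTopology_su2

namespace Summit.QuantumFields.YangMills.Theorems.SwapVirialDeficit.ZeroModeGroup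

/-! ## §21 Continuity of the profile at `κ = 0⁺` -/

/-- One pair, in the variable `κ`: off the `κ = 0` pair boundary, `pairSq + κC² ≤ R ↔ pairSq ≤ R` for all small `κ > 0`. [folklore] -/
theorem eventually_pairK_le_iff {P C R : ℝ} (h : P ≠ R) :
    ∀ᶠ κ in 𝓝[>] (0 : ℝ), (P + κ * C ^ 2 ≤ R ↔ P + 0 * C ^ 2 ≤ R) := by
  have h0 : (fun κ : ℝ => P + κ * C ^ 2) 0 ≠ (fun _ : ℝ => R) 0 := by simp only [zero_mul, add_zero]; exact h
  have hc : Continuous fun κ : ℝ => P + κ * C ^ 2 := by fun_prop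
  refine (eventually_le_iff_of_ne hc continuous_const h0).mono fun κ hκ => ?_
  exact hκ

/-- ★ Off the `κ = 0` pair boundaries, membership in `T(0, 0, κ)` is eventually (in `κ → 0⁺`) membership in `T(0, 0, 0)`. [folklore] -/
theorem mem_twoScale_limit_eventually_iff (w : (ℍ × ℍ) × ℍ)
    (hw : pairK 0 w.1.1 w.1.2 ≠ w.1.1.re ^ 2 * w.1.2.re ^ 2 ∧ pairK 0 w.1.1 w.2 ≠ w.1.1.re ^ 2 * w.2.re ^ 2 ∧
      pairK 0 w.1.2 w.2 ≠ w.1.2.re ^ 2 * w.2.re ^ 2) :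
    ∀ᶠ κ in 𝓝[>] (0 : ℝ), (w ∈ twoScaleSet4 0 0 κ ↔ w ∈ twoScaleSet4 0 0 0) := by
  obtain ⟨⟨x, y⟩, z⟩ := w
  obtain ⟨p1, p2, p3⟩ := hw
  simp only [pairK, pairSq, zero_mul, add_zero] at p1 p2 p3
  have q1 := eventually_pairK_le_iff (C := x.imJ * y.imK - x.imK * y.imJ) p1
  have q2 := eventually_pairK_le_iff (C := x.imJ * z.imK - x.imK * z.imJ) p2
  have q3 := eventually_pairK_le_iff (C := y.imJ * z.imK - y.imK * z.imJ) p3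
  filter_upwards [q1, q2, q3] with κ k1 k2 k3
  simp only [twoScaleSet4, Set.mem_setOf_eq, tsNorm_zero_zero]
  rw [k1, k2, k3]

/-- ★★ **`h(κ) → h(0)` as `κ → 0⁺`** (dominated convergence with the majorant `domSet4`; a.e. point is off the pair boundaries). [folklore] -/
theorem tendsto_volume_twoScale_limit_zero :
    Tendsto (fun κ : ℝ => (((volume : Measure ℍ).prod (volume : Measure ℍ)).prod (volume : Measure ℍ)) (twoScaleSet4 0 0 κ))
      (𝓝[>] (0 : ℝ)) (𝓝 ((((volume : Measure ℍ).prod (volume : Measure ℍ)).prod (volume : Measure ℍ)) (twoScaleSet4 0 0 0))) := by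
  refine tendsto_measure_of_ae_tendsto_indicator (𝓝[>] (0 : ℝ)) (measurableSet_twoScaleSet4 0 0 0)
    (fun κ => measurableSet_twoScaleSet4 0 0 κ) measurableSet_domSet4 volume_domSet4_lt_top.ne ?_ ?_
  · filter_upwards [self_mem_nhdsWithin] with κ hκ
    exact twoScaleSet4_subset_domSet4 le_rfl le_rfl (le_of_lt hκ)
  · filter_upwards [ae_not_boundary4 0] with w hw using mem_twoScale_limit_eventually_iff w hw.2.2

/-! ## §22 The profile vanishes at `κ → ∞` -/

/-- A line through the origin of `ℝ²` is null: `vol{(J, K) | aK − bJ = 0} = 0` for `a ≠ 0`. [folklore] -/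
theorem volume_line_null {a : ℝ} (ha : a ≠ 0) (b : ℝ) : volume {q : ℝ × ℝ | a * q.2 - b * q.1 = 0} = 0 := by
  have hm : MeasurableSet {q : ℝ × ℝ | a * q.2 - b * q.1 = 0} :=
    measurableSet_eq_fun ((measurable_snd.const_mul a).sub (measurable_fst.const_mul b)) measurable_const
  rw [Measure.volume_eq_prod, Measure.prod_apply hm]
  have hsec : ∀ J : ℝ, volume (Prod.mk J ⁻¹' {q : ℝ × ℝ | a * q.2 - b * q.1 = 0}) = 0 := by
    intro J
    have e : Prod.mk J ⁻¹' {q : ℝ × ℝ | a * q.2 - b * q.1 = 0} = {b * J / a} := by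
      ext K
      simp only [Set.mem_preimage, Set.mem_setOf_eq, Set.mem_singleton_iff]
      constructor
      · intro h; field_simp; linarith
      · intro h; rw [h]; field_simp; ring
    rw [e, Real.volume_singleton]
  simp_rw [hsec, lintegral_zero]

/-- The transverse parts of two letters are a.s. not parallel, `y`-section: for `x_J ≠ 0`, `vol{y | x_Jy_K − x_Ky_J = 0} = 0`
(in the coordinates ✓`coord4` the set is `ℝ × ℝ × (a null line)`). [folklore] -/
theorem volume_cross_section_null {x : ℍ} (hx : x.imJ ≠ 0) : (volume : Measure ℍ) {y : ℍ | x.imJ * y.imK - x.imK * y.imJ = 0} = 0 := by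
  have hL : MeasurableSet {q : ℝ × ℝ | x.imJ * q.2 - x.imK * q.1 = 0} :=
    measurableSet_eq_fun ((measurable_snd.const_mul _).sub (measurable_fst.const_mul _)) measurable_const
  have e : {y : ℍ | x.imJ * y.imK - x.imK * y.imJ = 0} =
      coord4 ⁻¹' ((Set.univ : Set ℝ) ×ˢ ((Set.univ : Set ℝ) ×ˢ {q : ℝ × ℝ | x.imJ * q.2 - x.imK * q.1 = 0})) := by
    ext y; simp [coord4]
  rw [e, measurePreserving_coord4.measure_preimage ((MeasurableSet.univ.prod (MeasurableSet.univ.prod hL)).nullMeasurableSet),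
    Measure.volume_eq_prod, Measure.prod_prod, Measure.volume_eq_prod, Measure.prod_prod, volume_line_null hx, mul_zero, mul_zero]

/-- ★ A.e. in `((x, y), z)` the transverse parts of `x` and `y` are not parallel: `x_Jy_K − x_Ky_J ≠ 0`. [folklore] -/
theorem ae_cross_ne_zero :
    ∀ᵐ w : (ℍ × ℍ) × ℍ ∂(((volume : Measure ℍ).prod (volume : Measure ℍ)).prod (volume : Measure ℍ)),
      w.1.1.imJ * w.1.2.imK - w.1.1.imK * w.1.2.imJ ≠ 0 := by
  have hS : MeasurableSet {q : ℍ × ℍ | q.1.imJ * q.2.imK - q.1.imK * q.2.imJ ≠ 0} := by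
    refine (measurableSet_eq_fun ?_ measurable_const).compl
    exact ((Quaternion.continuous_imJ.measurable.comp measurable_fst).mul (Quaternion.continuous_imK.measurable.comp measurable_snd)).sub
      ((Quaternion.continuous_imK.measurable.comp measurable_fst).mul (Quaternion.continuous_imJ.measurable.comp measurable_snd))
  have hpair : ∀ᵐ q : ℍ × ℍ ∂((volume : Measure ℍ).prod (volume : Measure ℍ)), q.1.imJ * q.2.imK - q.1.imK * q.2.imJ ≠ 0 := by
    refine (Measure.ae_prod_mem_iff_ae_ae_mem (μ := (volume : Measure ℍ)) (ν := (volume : Measure ℍ)) hS).2 ?_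
    have hJ : ∀ᵐ x : ℍ ∂(volume : Measure ℍ), x.imJ ≠ 0 := by
      rw [ae_iff]; simpa only [ne_eq, not_not] using volume_imJ_eq_zero
    filter_upwards [hJ] with x hx
    rw [ae_iff]
    simpa only [Set.mem_setOf_eq, ne_eq, not_not] using volume_cross_section_null hx
  exact (Measure.quasiMeasurePreserving_fst (μ := (volume : Measure ℍ).prod (volume : Measure ℍ)) (ν := (volume : Measure ℍ))).ae hpair

/-- If `C ≠ 0` then `P + κC² ≤ R` fails for all large `κ`. [folklore] -/
theorem eventually_not_pairK_le {P C R : ℝ} (hC : C ≠ 0) (hP : 0 ≤ P) : ∀ᶠ κ in atTop, ¬ (P + κ * C ^ 2 ≤ R) := by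
  have hC2 : 0 < C ^ 2 := by positivity
  filter_upwards [eventually_gt_atTop (R / C ^ 2)] with κ hκ
  intro h
  have : R / C ^ 2 * C ^ 2 < κ * C ^ 2 := mul_lt_mul_of_pos_right hκ hC2
  rw [div_mul_cancel₀ _ hC2.ne'] at this
  linarith

/-- ★★ **`h(κ) → 0` as `κ → ∞`**: a.e. point leaves `T(0, 0, κ)` for large `κ` (its first two letters have non-parallel transverse parts),
dominated convergence with the majorant `domSet4`. [folklore] -/
theorem tendsto_volume_twoScale_limit_atTop :
    Tendsto (fun κ : ℝ => (((volume : Measure ℍ).prod (volume : Measure ℍ)).prod (volume : Measure ℍ)) (twoScaleSet4 0 0 κ))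
      atTop (𝓝 0) := by
  have h := tendsto_measure_of_ae_tendsto_indicator (μ := (((volume : Measure ℍ).prod (volume : Measure ℍ)).prod (volume : Measure ℍ)))
    (atTop : Filter ℝ) (MeasurableSet.empty) (fun κ => measurableSet_twoScaleSet4 0 0 κ) measurableSet_domSet4 volume_domSet4_lt_top.ne ?_ ?_
  · simpa only [measure_empty] using h
  · filter_upwards [eventually_ge_atTop (0 : ℝ)] with κ hκ
    exact twoScaleSet4_subset_domSet4 le_rfl le_rfl hκ
  · filter_upwards [ae_cross_ne_zero] with w hw
    obtain ⟨⟨x, y⟩, z⟩ := w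
    have hP : 0 ≤ (x.imK * y.imI - x.imI * y.imK) ^ 2 + (x.imI * y.imJ - x.imJ * y.imI) ^ 2 := by positivity
    filter_upwards [eventually_not_pairK_le (R := tsNorm 0 0 x * tsNorm 0 0 y) hw hP] with κ hκ
    simp only [Set.mem_empty_iff_false, iff_false, twoScaleSet4, Set.mem_setOf_eq, not_and]
    intro _ _ _ _ _ _ h7
    exact absurd h7 hκ

/-! ## §23 The profile is positive -/

/-- An explicit box inside every limit event: letters with `x₀ ∈ (½, 1)`, `|x_I| < 1`, `|x_J|, |x_K| < δ` where `δ = 1/(16(1 + κ))`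
(then `x_J² + x_K² < 2δ² < ¼ < x₀²` and the pair functional is `≤ 8δ² + 4κδ⁴ ≤ 1/16 ≤ x₀²y₀²`). [folklore] -/
def limitBox (κ : ℝ) : Set ℍ :=
  {x | 1 / 2 < x.re ∧ x.re < 1 ∧ -1 < x.imI ∧ x.imI < 1 ∧ -(1 / (16 * (1 + κ))) < x.imJ ∧ x.imJ < 1 / (16 * (1 + κ)) ∧
    -(1 / (16 * (1 + κ))) < x.imK ∧ x.imK < 1 / (16 * (1 + κ))}

/-- The box side `δ = 1/(16(1+κ))` is positive, at most `1/16`, and `κδ ≤ 1/16` (`κ ≥ 0`). [folklore] -/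
theorem limitBox_delta_bounds {κ : ℝ} (hκ : 0 ≤ κ) :
    0 < 1 / (16 * (1 + κ)) ∧ 1 / (16 * (1 + κ)) ≤ 1 / 16 ∧ κ * (1 / (16 * (1 + κ))) ≤ 1 / 16 := by
  refine ⟨by positivity, ?_, ?_⟩
  · rw [div_le_div_iff₀ (by positivity) (by norm_num)]; nlinarith
  · rw [← mul_div_assoc, mul_one, div_le_div_iff₀ (by positivity) (by norm_num)]; nlinarith

/-- The numerical heart of the box: `8δ² + 4κδ⁴ ≤ 1/16` for `0 < δ ≤ 1/16`, `κδ ≤ 1/16`, `κ ≥ 0`. [folklore] -/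
theorem limitBox_key {κ δ : ℝ} (hκ : 0 ≤ κ) (hδpos : 0 < δ) (hδ16 : δ ≤ 1 / 16) (hκδ : κ * δ ≤ 1 / 16) :
    (2 * δ) ^ 2 + (2 * δ) ^ 2 + κ * (2 * δ ^ 2) ^ 2 ≤ 1 / 16 := by
  have d2 : δ ^ 2 ≤ (1 / 16) ^ 2 := pow_le_pow_left₀ hδpos.le hδ16 2
  have d3 : δ ^ 3 ≤ (1 / 16) ^ 3 := pow_le_pow_left₀ hδpos.le hδ16 3
  have e : (2 * δ) ^ 2 + (2 * δ) ^ 2 + κ * (2 * δ ^ 2) ^ 2 = 8 * δ ^ 2 + 4 * (κ * δ) * δ ^ 3 := by ring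
  have d4 : 4 * (κ * δ) * δ ^ 3 ≤ 4 * (1 / 16) * (1 / 16) ^ 3 := by
    have h0 : 0 ≤ κ * δ := mul_nonneg hκ hδpos.le
    have h1 : 0 ≤ δ ^ 3 := by positivity
    nlinarith only [hκδ, d3, h0, h1]
  rw [e]
  linarith

/-- One pair of box letters satisfies the pair constraint of `T(0, 0, κ)` (`κ ≥ 0`). [folklore] -/
theorem pairK_le_of_mem_limitBox {κ : ℝ} (hκ : 0 ≤ κ) {x y : ℍ} (hx : x ∈ limitBox κ) (hy : y ∈ limitBox κ) :
    (x.imK * y.imI - x.imI * y.imK) ^ 2 + (x.imI * y.imJ - x.imJ * y.imI) ^ 2 + κ * (x.imJ * y.imK - x.imK * y.imJ) ^ 2 ≤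
      tsNorm 0 0 x * tsNorm 0 0 y := by
  obtain ⟨hx1, -, hxI1, hxI2, hxJ1, hxJ2, hxK1, hxK2⟩ := hx
  obtain ⟨hy1, -, hyI1, hyI2, hyJ1, hyJ2, hyK1, hyK2⟩ := hy
  obtain ⟨hδpos, hδ16, hκδ⟩ := limitBox_delta_bounds hκ
  have key := limitBox_key hκ hδpos hδ16 hκδ
  rw [tsNorm_zero_zero, tsNorm_zero_zero]
  set δ : ℝ := 1 / (16 * (1 + κ)) with hδ
  have aI : |x.imI| < 1 := abs_lt.2 ⟨hxI1, hxI2⟩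
  have bI : |y.imI| < 1 := abs_lt.2 ⟨hyI1, hyI2⟩
  have aJ : |x.imJ| < δ := abs_lt.2 ⟨hxJ1, hxJ2⟩
  have aK : |x.imK| < δ := abs_lt.2 ⟨hxK1, hxK2⟩
  have bJ : |y.imJ| < δ := abs_lt.2 ⟨hyJ1, hyJ2⟩
  have bK : |y.imK| < δ := abs_lt.2 ⟨hyK1, hyK2⟩
  have t1 : |x.imK * y.imI - x.imI * y.imK| ≤ 2 * δ := by
    calc |x.imK * y.imI - x.imI * y.imK| ≤ |x.imK * y.imI| + |x.imI * y.imK| := abs_sub _ _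
      _ = |x.imK| * |y.imI| + |x.imI| * |y.imK| := by rw [abs_mul, abs_mul]
      _ ≤ δ * 1 + 1 * δ := by gcongr
      _ = 2 * δ := by ring
  have t2 : |x.imI * y.imJ - x.imJ * y.imI| ≤ 2 * δ := by
    calc |x.imI * y.imJ - x.imJ * y.imI| ≤ |x.imI * y.imJ| + |x.imJ * y.imI| := abs_sub _ _
      _ = |x.imI| * |y.imJ| + |x.imJ| * |y.imI| := by rw [abs_mul, abs_mul]
      _ ≤ 1 * δ + δ * 1 := by gcongr
      _ = 2 * δ := by ring
  have t3 : |x.imJ * y.imK - x.imK * y.imJ| ≤ 2 * δ ^ 2 := by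
    calc |x.imJ * y.imK - x.imK * y.imJ| ≤ |x.imJ * y.imK| + |x.imK * y.imJ| := abs_sub _ _
      _ = |x.imJ| * |y.imK| + |x.imK| * |y.imJ| := by rw [abs_mul, abs_mul]
      _ ≤ δ * δ + δ * δ := by gcongr
      _ = 2 * δ ^ 2 := by ring
  have s1 : (x.imK * y.imI - x.imI * y.imK) ^ 2 ≤ (2 * δ) ^ 2 := by
    rw [← sq_abs]; exact pow_le_pow_left₀ (abs_nonneg _) t1 2
  have s2 : (x.imI * y.imJ - x.imJ * y.imI) ^ 2 ≤ (2 * δ) ^ 2 := by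
    rw [← sq_abs]; exact pow_le_pow_left₀ (abs_nonneg _) t2 2
  have s3 : (x.imJ * y.imK - x.imK * y.imJ) ^ 2 ≤ (2 * δ ^ 2) ^ 2 := by
    rw [← sq_abs]; exact pow_le_pow_left₀ (abs_nonneg _) t3 2
  have s3' : κ * (x.imJ * y.imK - x.imK * y.imJ) ^ 2 ≤ κ * (2 * δ ^ 2) ^ 2 := mul_le_mul_of_nonneg_left s3 hκ
  have hx2 : 1 / 4 ≤ x.re ^ 2 := by nlinarith only [hx1]
  have hy2 : 1 / 4 ≤ y.re ^ 2 := by nlinarith only [hy1]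
  have hr : 1 / 16 ≤ x.re ^ 2 * y.re ^ 2 := by
    have := mul_le_mul hx2 hy2 (by norm_num) (sq_nonneg x.re)
    linarith
  linarith only [s1, s2, s3', key, hr]

/-- The box (cubed) lies in the limit event (`κ ≥ 0`). [folklore] -/
theorem limitBox_prod_subset {κ : ℝ} (hκ : 0 ≤ κ) :
    (limitBox κ ×ˢ limitBox κ) ×ˢ limitBox κ ⊆ twoScaleSet4 0 0 κ := by
  rintro ⟨⟨x, y⟩, z⟩ ⟨⟨hx, hy⟩, hz⟩
  obtain ⟨hδpos, hδ16, -⟩ := limitBox_delta_bounds hκ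
  have ball : ∀ {u : ℍ}, u ∈ limitBox κ → tsNorm 0 0 u < 1 := by
    intro u hu; obtain ⟨h1, h2, -⟩ := hu; rw [tsNorm_zero_zero]; nlinarith only [h1, h2]
  have hub : ∀ {u : ℍ}, u ∈ limitBox κ → u.imJ ^ 2 + u.imK ^ 2 ≤ tsNorm 0 0 u := by
    intro u hu
    obtain ⟨h1, -, -, -, hJ1, hJ2, hK1, hK2⟩ := hu
    rw [tsNorm_zero_zero]
    have aJ : |u.imJ| < 1 / 16 := lt_of_lt_of_le (abs_lt.2 ⟨hJ1, hJ2⟩) hδ16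
    have aK : |u.imK| < 1 / 16 := lt_of_lt_of_le (abs_lt.2 ⟨hK1, hK2⟩) hδ16
    have sJ : u.imJ ^ 2 < (1 / 16) ^ 2 := by rw [← sq_abs]; exact pow_lt_pow_left₀ aJ (abs_nonneg _) two_ne_zero
    have sK : u.imK ^ 2 < (1 / 16) ^ 2 := by rw [← sq_abs]; exact pow_lt_pow_left₀ aK (abs_nonneg _) two_ne_zero
    have hu2 : 1 / 4 ≤ u.re ^ 2 := by nlinarith only [h1]
    linarith only [sJ, sK, hu2]
  exact ⟨ball hx, ball hy, ball hz, hub hx, hub hy, hub hz, pairK_le_of_mem_limitBox hκ hx hy, pairK_le_of_mem_limitBox hκ hx hz,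
    pairK_le_of_mem_limitBox hκ hy hz⟩

/-- The box has positive volume: it is the ✓`coord4`-preimage of a product of nonempty open intervals. [folklore] -/
theorem volume_limitBox_pos {κ : ℝ} (hκ : 0 ≤ κ) : 0 < (volume : Measure ℍ) (limitBox κ) := by
  obtain ⟨hδpos, -, -⟩ := limitBox_delta_bounds hκ
  set δ : ℝ := 1 / (16 * (1 + κ)) with hδ
  have e : limitBox κ = coord4 ⁻¹' (Ioo (1 / 2 : ℝ) 1 ×ˢ (Ioo (-1 : ℝ) 1 ×ˢ (Ioo (-δ) δ ×ˢ Ioo (-δ) δ))) := by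
    ext x
    simp only [limitBox, coord4, Set.mem_preimage, Set.mem_prod, Set.mem_Ioo, Set.mem_setOf_eq]
    tauto
  rw [e, measurePreserving_coord4.measure_preimage
    ((measurableSet_Ioo.prod (measurableSet_Ioo.prod (measurableSet_Ioo.prod measurableSet_Ioo))).nullMeasurableSet),
    Measure.volume_eq_prod, Measure.prod_prod, Measure.volume_eq_prod, Measure.prod_prod, Measure.volume_eq_prod, Measure.prod_prod,
    Real.volume_Ioo, Real.volume_Ioo, Real.volume_Ioo]
  have h1 : 0 < ENNReal.ofReal ((1 : ℝ) - 1 / 2) := ENNReal.ofReal_pos.2 (by norm_num)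
  have h2 : 0 < ENNReal.ofReal ((1 : ℝ) - -1) := ENNReal.ofReal_pos.2 (by norm_num)
  have h3 : 0 < ENNReal.ofReal (δ - -δ) := ENNReal.ofReal_pos.2 (by linarith)
  exact ENNReal.mul_pos h1.ne' (ENNReal.mul_pos h2.ne' (ENNReal.mul_pos h3.ne' h3.ne').ne').ne'

/-- ★★ **The profile is positive**: `h(κ) = vol³(T(0, 0, κ)) > 0` for every `κ ≥ 0`; in particular `h(0) > 0` — the candidate coefficient of
`t⁶·log(1/t)` is positive (and finite, part IV-c). [folklore] -/
theorem volume_twoScale_limit_pos {κ : ℝ} (hκ : 0 ≤ κ) :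
    0 < (((volume : Measure ℍ).prod (volume : Measure ℍ)).prod (volume : Measure ℍ)) (twoScaleSet4 0 0 κ) := by
  have hB := volume_limitBox_pos hκ
  refine lt_of_lt_of_le ?_ (measure_mono (limitBox_prod_subset hκ))
  rw [Measure.prod_prod, Measure.prod_prod]
  exact ENNReal.mul_pos (ENNReal.mul_pos hB.ne' hB.ne').ne' hB.ne'

end Summit.QuantumFields.YangMills.Theorems.SwapVirialDeficit.ZeroModeGroup

end
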